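import Mathlib
import Summits.Ventures.FusionMHD.Models.SAlphaStableS05A025
import Summits.Ventures.FusionMHD.Models.SAlphaStableS1A055
import Summits.Ventures.FusionMHD.Models.SAlphaStableS15A075
import Summits.Ventures.FusionMHD.Models.SAlphaStableS2A10
import Summits.Ventures.FusionMHD.Models.SAlphaStableS25A125
import Summits.Ventures.FusionMHD.Models.SAlphaStableS3A16
import Summits.Ventures.FusionMHD.Models.SAlphaStableS075A04
import Summits.Ventures.FusionMHD.Models.SAlphaStableS125A0625
import Summits.Ventures.FusionMHD.Models.SAlphaTwoTurnBump
import Summits.Ventures.FusionMHD.Models.SAlphaQuarticBumpShears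
import HarnessLib

/-!
# F3 row «F3.BALLOON-sα-FIRST-STABILITY-CURVE-BRACKETS»: the first-stability boundary of the `s–α` ballooning
# MODEL is BRACKETED at six shears (v2: eight) — a certified stable surface below it and a certified instability witness above it

LADDER-GRIDFUSION rung F3 (cell `gridfusion`).  Assembly BY NAME (gridfusion-lit-4 g12, 2026-08-28) of
* the STABLE SIDE — lit-4's engine `Literature/MathematicalPhysics/MHD/BallooningSAlphaStableSide.lean`
  (`SAlpha.StableSide s α := ∀ a b X X′, ¬ SAlpha.UnstableWitness s α a b X X′`; Riccati–Picone in Liouville amplitude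
  form + explicit two-scale tail) instantiated in `SAlphaStableS05A025.lean` (`(s, α) = (1/2, 1/4)`),
  `SAlphaStableS1A055.lean` (`(1, 11/20)`), `SAlphaStableS15A075.lean` (`(3/2, 3/4)`), `SAlphaStableS2A10.lean` (`(2, 1)`),
  `SAlphaStableS25A125.lean` (`(5/2, 5/4)`), `SAlphaStableS3A16.lean` (`(3, 8/5)`),
  each core inequality certified by graded Taylor-model exclusion leaves of
  `Literature/Analysis/ValidatedNumerics/TaylorModelZeroCert.lean` (`decide +kernel`), tail and junction by `norm_num`;
* the UNSTABLE SIDE — gridfusion-model-7's two-turn bump ★ #192 (`SAlphaTwoTurnBump.lean`: explicit compactly supported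
  trial functions on `[−2π, 2π]` with negative one-surface energy at `(1/2, 1/2)`, `(1, 67/100)`, `(3/2, 21/20)`, `(2, 3/2)`;
  its closed form `ttConic` evaluated at `(5/2, 7/4)`, `(3, 11/5)` in lit-4's `SAlphaQuarticBumpShears.lean` §TT) and, further
  inside the band, the quartic-bump conic segments of ★ #184 / `SAlphaQuarticBumpShears.lean`.
0 kit in the kernel, 0 named facts, no new computation: this file only conjoins landed theorems.

## What is PROVED (`brackets`; MODEL statements)
| shear `s` | certified STABLE surface `α₋` (no witness on any window) | certified UNSTABLE surface `α₊` (explicit witness) |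
|---|---|---|
| `1/2` | `1/4`  (`SAlphaStableS05A025.stableSide`) | `1/2`   (`SAlphaTwoTurnBump.unstableWitness_tt_half_half`) |
| `1`   | `11/20` (`SAlphaStableS1A055.stableSide`) | `67/100` (`SAlphaTwoTurnBump.unstableWitness_tt_one_067`) |
| `3/2` | `3/4`  (`SAlphaStableS15A075.stableSide`) | `21/20` (`SAlphaTwoTurnBump.unstableWitness_tt_threehalves_105`) |
| `2`   | `1`    (`SAlphaStableS2A10.stableSide`)   | `3/2`   (`SAlphaTwoTurnBump.unstableWitness_tt_two_threehalves`) |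
| `5/2` | `5/4`  (`SAlphaStableS25A125.stableSide`) | `7/4`   (`SAlphaQuarticBumpShears.unstableWitness_tt_fiveHalves_74`) |
| `3`   | `8/5`  (`SAlphaStableS3A16.stableSide`)   | `11/5`  (`SAlphaQuarticBumpShears.unstableWitness_tt_three_115`) |
| `3/4` (v2) | `2/5` (`SAlphaStableS075A04.stableSide`) | `23/40` (`SAlphaQuarticBumpShears.unstableWitness_tt_threeQuarters_0575`) |
| `5/4` (v2) | `5/8` (`SAlphaStableS125A0625.stableSide`) | `33/40` (`SAlphaQuarticBumpShears.unstableWitness_tt_fiveQuarters_0825`) |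

and (`quartic_segments`) whole unstable SEGMENTS by the one-transit quartic bump: `[3/5, 6/5]` at `s = 1/2`,
`[87/100, 227/100]` at `s = 1`, `[27/20, 5/2]` at `s = 3/2`, `[19/10, 3]` at `s = 2`.

## THREE COLUMNS
CERTIFIED: in the `s–α` MODEL (Freidberg (12.96)–(12.99)), writing `U_s` for the set of `α` at which the surface `(s, α)`
carries a compactly supported trial function with negative one-surface energy: `α₋(s) ∉ U_s` and `α₊(s) ∈ U_s` at the
six shears of the table, hence `inf {α ≥ α₋(s) : α ∈ U_s}` lies in the CLOSED interval `[α₋(s), α₊(s)]` =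
`[1/4, 1/2]`, `[11/20, 67/100]`, `[3/4, 21/20]`, `[1, 3/2]`, `[5/4, 7/4]`, `[8/5, 11/5]` at `s = 1/2, 1, 3/2, 2, 5/2, 3`
(v2 `brackets_v2`: also `[2/5, 23/40]` at `s = 3/4` and `[5/8, 33/40]` at `s = 5/4`) —
monotonicity / continuity in `α` and in `s` are NOT typed (the model has a second stable region at large `α`; nothing is
claimed between the six shears).  VALIDATED (never in the kernel): Freidberg Fig. 12.5 and p. 491 («`α = K s`, `K ≈ 0.6`» for the first
boundary at small shear); shooting of the Euler–Lagrange equation of (12.97) (kit j299948 / j301608, floats): first unstable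
`α ≈ 0.395, 0.615, 0.885, 1.18, 1.49, 1.815` at `s = 1/2, 1, 3/2, 2, 5/2, 3` (and `0.495, 0.745` at `s = 3/4, 5/4`) — inside each
certified bracket; referee shootings at `s = 1`:
`0.612 / 0.613 / 0.624`.  MODELLED: `s–α` model (large-aspect-ratio shifted circles, high-`n` ballooning ordering,
`θ₀ = 0`, ideal MHD); «stable» = the one-surface quadratic form is `≥ 0` on every compactly supported admissible trial
function, «unstable» = an explicit trial function makes it `< 0`; the representation step `W̄ < 0 somewhere ⇔ 2-D
δW < 0` (Connor–Hastie–Taylor 1979) is QUOTED in lit-3's file, not typed; nothing about a device, no `β` limit.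

Citations: J. P. Freidberg, *Ideal MHD* (CUP 2014) §12.3, §12.6.2 (12.96)–(12.100), Fig. 12.5 [Freidberg2014];
P. Hartman, *ODE* (2002) Ch. XI §6 [Hartman2002].  Everything here is [instance data].
-/

noncomputable section

open Real Set
open Literature.MathematicalPhysics.MHD.Ballooning

namespace Summit.Ventures.FusionMHD.Models

namespace SAlphaFirstStabilityBrackets

/-- **THE SIX TWO-SIDED BRACKETS** of the `s–α` MODEL's first-stability boundary at `s = 1/2, 1, 3/2, 2, 5/2, 3`: at
each shear the lower surface is on the stable side (no instability witness on any window) and the upper surface carries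
model-7's two-turn-bump witness on `[−2π, 2π]`. MODEL statement; no device. [instance data] -/
theorem brackets :
    (SAlpha.StableSide (1 / 2) (1 / 4) ∧
        SAlpha.UnstableWitness (1 / 2) (1 / 2) (-(2 * π)) (2 * π) SAlphaTwoTurnBump.ttX SAlphaTwoTurnBump.ttX') ∧
      (SAlpha.StableSide 1 (11 / 20) ∧
        SAlpha.UnstableWitness 1 (67 / 100) (-(2 * π)) (2 * π) SAlphaTwoTurnBump.ttX SAlphaTwoTurnBump.ttX') ∧
      (SAlpha.StableSide (3 / 2) (3 / 4) ∧
        SAlpha.UnstableWitness (3 / 2) (21 / 20) (-(2 * π)) (2 * π) SAlphaTwoTurnBump.ttX SAlphaTwoTurnBump.ttX') ∧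
      (SAlpha.StableSide 2 1 ∧
        SAlpha.UnstableWitness 2 (3 / 2) (-(2 * π)) (2 * π) SAlphaTwoTurnBump.ttX SAlphaTwoTurnBump.ttX') ∧
      (SAlpha.StableSide (5 / 2) (5 / 4) ∧
        SAlpha.UnstableWitness (5 / 2) (7 / 4) (-(2 * π)) (2 * π) SAlphaTwoTurnBump.ttX SAlphaTwoTurnBump.ttX') ∧
      (SAlpha.StableSide 3 (8 / 5) ∧
        SAlpha.UnstableWitness 3 (11 / 5) (-(2 * π)) (2 * π) SAlphaTwoTurnBump.ttX SAlphaTwoTurnBump.ttX') :=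
  ⟨⟨SAlphaStableS05A025.stableSide, SAlphaTwoTurnBump.unstableWitness_tt_half_half⟩,
    ⟨SAlphaStableS1A055.stableSide, SAlphaTwoTurnBump.unstableWitness_tt_one_067⟩,
    ⟨SAlphaStableS15A075.stableSide, SAlphaTwoTurnBump.unstableWitness_tt_threehalves_105⟩,
    ⟨SAlphaStableS2A10.stableSide, SAlphaTwoTurnBump.unstableWitness_tt_two_threehalves⟩,
    ⟨SAlphaStableS25A125.stableSide, SAlphaQuarticBumpShears.unstableWitness_tt_fiveHalves_74⟩,
    ⟨SAlphaStableS3A16.stableSide, SAlphaQuarticBumpShears.unstableWitness_tt_three_115⟩⟩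

/-- **THE QUARTIC-BUMP SEGMENTS** above the brackets: at the shears `s = 1/2, 1, 3/2, 2` a whole `α`-interval of surfaces
carries the one-transit quartic-bump witness of ★ #184 on `[−π, π]`. MODEL statement; no device. [instance data] -/
theorem quartic_segments :
    (∀ α : ℝ, 3 / 5 ≤ α → α ≤ 6 / 5 →
        SAlpha.UnstableWitness (1 / 2) α (-π) π SAlphaQuarticBump.bumpX SAlphaQuarticBump.bumpX') ∧
      (∀ α : ℝ, 87 / 100 ≤ α → α ≤ 227 / 100 →
        SAlpha.UnstableWitness 1 α (-π) π SAlphaQuarticBump.bumpX SAlphaQuarticBump.bumpX') ∧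
      (∀ α : ℝ, 27 / 20 ≤ α → α ≤ 5 / 2 →
        SAlpha.UnstableWitness (3 / 2) α (-π) π SAlphaQuarticBump.bumpX SAlphaQuarticBump.bumpX') ∧
      (∀ α : ℝ, 19 / 10 ≤ α → α ≤ 3 →
        SAlpha.UnstableWitness 2 α (-π) π SAlphaQuarticBump.bumpX SAlphaQuarticBump.bumpX') :=
  ⟨fun _ h1 h2 => SAlphaQuarticBumpShears.unstableWitness_half_of_mem h1 h2,
    fun _ h1 h2 => SAlphaQuarticBump.unstableWitness_one_of_mem h1 h2,
    fun _ h1 h2 => SAlphaQuarticBumpShears.unstableWitness_threeHalves_of_mem h1 h2,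
    fun _ h1 h2 => SAlphaQuarticBumpShears.unstableWitness_two_of_mem h1 h2⟩

/-- The stable side BELOW the bracket at each shear, read as «no instability witness on any window». [instance data] -/
theorem no_witness_below (a b : ℝ) (X X' : ℝ → ℝ) :
    ¬ SAlpha.UnstableWitness (1 / 2) (1 / 4) a b X X' ∧ ¬ SAlpha.UnstableWitness 1 (11 / 20) a b X X' ∧
      ¬ SAlpha.UnstableWitness (3 / 2) (3 / 4) a b X X' ∧ ¬ SAlpha.UnstableWitness 2 1 a b X X' ∧
      ¬ SAlpha.UnstableWitness (5 / 2) (5 / 4) a b X X' ∧ ¬ SAlpha.UnstableWitness 3 (8 / 5) a b X X' :=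
  ⟨SAlphaStableS05A025.stableSide a b X X', SAlphaStableS1A055.stableSide a b X X',
    SAlphaStableS15A075.stableSide a b X X', SAlphaStableS2A10.stableSide a b X X',
    SAlphaStableS25A125.stableSide a b X X', SAlphaStableS3A16.stableSide a b X X'⟩

/-! ### v2: the shears `s = 3/4` and `s = 5/4` -/

/-- **TWO MORE BRACKETS (v2)** at `s = 3/4` and `s = 5/4`: stable side at `α = 2/5`, resp. `5/8` (lit-4 instances
`SAlphaStableS075A04`, `SAlphaStableS125A0625`) and model-7's two-turn-bump witness (closed form `ttConic` BY NAME,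
evaluated in `SAlphaQuarticBumpShears` §TT2) at `α = 23/40`, resp. `33/40`. MODEL statement; no device. [instance data] -/
theorem brackets_v2 :
    (SAlpha.StableSide (3 / 4) (2 / 5) ∧
        SAlpha.UnstableWitness (3 / 4) (23 / 40) (-(2 * π)) (2 * π) SAlphaTwoTurnBump.ttX SAlphaTwoTurnBump.ttX') ∧
      (SAlpha.StableSide (5 / 4) (5 / 8) ∧
        SAlpha.UnstableWitness (5 / 4) (33 / 40) (-(2 * π)) (2 * π) SAlphaTwoTurnBump.ttX SAlphaTwoTurnBump.ttX') :=
  ⟨⟨SAlphaStableS075A04.stableSide, SAlphaQuarticBumpShears.unstableWitness_tt_threeQuarters_0575⟩,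
    ⟨SAlphaStableS125A0625.stableSide, SAlphaQuarticBumpShears.unstableWitness_tt_fiveQuarters_0825⟩⟩

/-- All EIGHT brackets (`s = 1/2, 1, 3/2, 2, 5/2, 3` of `brackets` and `s = 3/4, 5/4` of `brackets_v2`). [instance data] -/
theorem brackets_eight :
    ((SAlpha.StableSide (1 / 2) (1 / 4) ∧
        SAlpha.UnstableWitness (1 / 2) (1 / 2) (-(2 * π)) (2 * π) SAlphaTwoTurnBump.ttX SAlphaTwoTurnBump.ttX') ∧
      (SAlpha.StableSide 1 (11 / 20) ∧
        SAlpha.UnstableWitness 1 (67 / 100) (-(2 * π)) (2 * π) SAlphaTwoTurnBump.ttX SAlphaTwoTurnBump.ttX') ∧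
      (SAlpha.StableSide (3 / 2) (3 / 4) ∧
        SAlpha.UnstableWitness (3 / 2) (21 / 20) (-(2 * π)) (2 * π) SAlphaTwoTurnBump.ttX SAlphaTwoTurnBump.ttX') ∧
      (SAlpha.StableSide 2 1 ∧
        SAlpha.UnstableWitness 2 (3 / 2) (-(2 * π)) (2 * π) SAlphaTwoTurnBump.ttX SAlphaTwoTurnBump.ttX') ∧
      (SAlpha.StableSide (5 / 2) (5 / 4) ∧
        SAlpha.UnstableWitness (5 / 2) (7 / 4) (-(2 * π)) (2 * π) SAlphaTwoTurnBump.ttX SAlphaTwoTurnBump.ttX') ∧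
      (SAlpha.StableSide 3 (8 / 5) ∧
        SAlpha.UnstableWitness 3 (11 / 5) (-(2 * π)) (2 * π) SAlphaTwoTurnBump.ttX SAlphaTwoTurnBump.ttX')) ∧
    ((SAlpha.StableSide (3 / 4) (2 / 5) ∧
        SAlpha.UnstableWitness (3 / 4) (23 / 40) (-(2 * π)) (2 * π) SAlphaTwoTurnBump.ttX SAlphaTwoTurnBump.ttX') ∧
      (SAlpha.StableSide (5 / 4) (5 / 8) ∧
        SAlpha.UnstableWitness (5 / 4) (33 / 40) (-(2 * π)) (2 * π) SAlphaTwoTurnBump.ttX SAlphaTwoTurnBump.ttX')) :=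
  ⟨brackets, brackets_v2⟩

/-- The stable side BELOW the two v2 brackets: no instability witness on any window. [instance data] -/
theorem no_witness_below_v2 (a b : ℝ) (X X' : ℝ → ℝ) :
    ¬ SAlpha.UnstableWitness (3 / 4) (2 / 5) a b X X' ∧ ¬ SAlpha.UnstableWitness (5 / 4) (5 / 8) a b X X' :=
  ⟨SAlphaStableS075A04.stableSide a b X X', SAlphaStableS125A0625.stableSide a b X X'⟩

end SAlphaFirstStabilityBrackets

end Summit.Ventures.FusionMHD.Models

end
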